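import Summits.CriticalPhenomena.SAWScalingLimit.Theorems.SAWDevelopingMapObservableToSLECanonicalTransferEscapeFloor
import Summits.CriticalPhenomena.SAWScalingLimit.Theorems.SAWDevelopingMapObservableToSLECanonicalTransferFill
import Summits.CriticalPhenomena.SAWScalingLimit.Theorems.SAWDevelopingMapObservableToSLECanonicalTransferLimit
import HarnessLib

/-!
# Crux `SAWDevelopingMap.ObservableToSLE` (stmt-CriticalPhenomena-10472), line
`floor-ratio-restriction-bootstrap`, stub `stub_canonicalTransfer`: the inner domain at a fixed
mesh (inner admissible discretisation (M1))

Landing target: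
`Summits/CriticalPhenomena/SAWScalingLimit/Theorems/SAWDevelopingMapObservableToSLECanonicalTransferInner.lean`
(`--supports stmt-CriticalPhenomena-10472`).  Sequel of `…CanonicalTransferEscapeFloor.lean` and
`…CanonicalTransferFill.lean`.

At a fixed mesh `δ`, the inner domain of a floor Jordan domain `Ω` is the component `G` of a bulk
vertex `v₀` in the set `S` of deep vertices (`δ c_u ∈ Ω`, height `≥ η`, closed `r`-disc inside
`Ω ∪ B(p₀, ϱ) ∪ B(p₁, ϱ)` above the floor line — floor-friendly depth).  Here:

* `exists_pathIn_compl_component` — every vertex outside `G` escapes to below the floor avoiding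
  `G` (escape lemma + greedy descent inside a foreign component);
* `exists_inner_finset` = registered sub-goal `stub_canonicalTransfer_innerFloor` — **`G` is a finite,
  simply connected, connected vertex domain** (it is its own fill, `exists_fill`);
* `pathIn_of_deep_walk` — walks through `r`-deep vertices run inside `S`;
* `pathIn_of_near_floor_point` — EXACT FLOOR ROWS: vertices above the floor row within `ρ/16` of
  a floor point are in `G` (greedy ascent into a target disc joined to the bulk);
* `segment_subset_of_deep` — NO BAD EDGES: rescaled edges at deep vertices stay in `Ω`.
-/

noncomputable section

open scoped Topology
open Filter Set Metric
open Literature.Probability.LatticeModels (HexVertex hexGraph hexCenter Site)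
open Literature.Probability.RandomPlanarGeometry
open Literature.Probability.RandomPlanarGeometry.SAW
open Literature.Probability.Percolation (PathIn)

namespace Summit.CriticalPhenomena.SAWScalingLimit.Theorems.ObservableToSLE.FloorRatio

/-! ### The inner domain at a fixed mesh: the main component of the deep vertices -/

section Inner

open Summit.CriticalPhenomena.SAWScalingLimit.Theorems.ObservableToSLE.Negative
  (finite_embMeshVertices_hex)

/-- A path inside `A` from `u` is a path inside the `A`-component of `u`. [folklore] -/
theorem pathIn_component {V : Type*} {Γ : SimpleGraph V} {A : Set V} {u v : V}
    (h : PathIn Γ A u v) : PathIn Γ {x | PathIn Γ A u x} u v := by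
  obtain ⟨hu, h⟩ := h
  induction h with
  | refl => exact PathIn.refl (PathIn.refl hu)
  | @tail b c _ hbc ih =>
    have hb : PathIn Γ A u b := ih.right_mem
    exact ih.tail hbc.1 (hb.tail hbc.1 hbc.2)

/-- **Escape from outside the main component.**  In the setting of `exists_pathIn_escape`, with
`S` exactly the set of deep vertices, every vertex outside the `S`-component of `v₀` is joined,
avoiding that component, to a vertex at height `≤ h - 5δ`: a non-deep vertex by the escape lemma;
a deep vertex of another component by greedy descent to its first non-deep vertex (the initial
piece stays in its own component) followed by the escape lemma. [folklore] -/
theorem exists_pathIn_compl_component {Ω : Set ℂ} {h ρ ϱ δ r η : ℝ} {p₀ p₁ : ℂ}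
    {S : Set HexVertex} (hΩh : Ω ⊆ {z : ℂ | h < z.im}) (hE : IsConnected (closure Ω)ᶜ)
    (hEfr : frontier (closure Ω)ᶜ = frontier Ω)
    (hfl₀ : {z : ℂ | h < z.im} ∩ ball p₀ ρ ⊆ Ω) (hfl₁ : {z : ℂ | h < z.im} ∩ ball p₁ ρ ⊆ Ω)
    (hϱρ : ϱ + δ ≤ ρ) (hδ : 0 < δ) (hr : 25 * δ ≤ r)
    (hS : ∀ u, u ∈ S ↔ ((δ : ℂ) * hexCenter u ∈ Ω ∧ η ≤ ((δ : ℂ) * hexCenter u).im ∧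
      closedBall ((δ : ℂ) * hexCenter u) r ∩ {z : ℂ | h < z.im} ⊆ Ω ∪ ball p₀ ϱ ∪ ball p₁ ϱ))
    (v₀ : HexVertex) {z : HexVertex} (hz : ¬ PathIn hexGraph S v₀ z) :
    ∃ w : HexVertex, ((δ : ℂ) * hexCenter w).im ≤ h - 5 * δ ∧
      PathIn hexGraph {x | PathIn hexGraph S v₀ x}ᶜ z w := by
  set G : Set HexVertex := {x | PathIn hexGraph S v₀ x} with hG
  have hS' : ∀ u ∈ S, (δ : ℂ) * hexCenter u ∈ Ω ∧ η ≤ ((δ : ℂ) * hexCenter u).im ∧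
      closedBall ((δ : ℂ) * hexCenter u) r ∩ {z : ℂ | h < z.im} ⊆ Ω ∪ ball p₀ ϱ ∪ ball p₁ ϱ := fun u hu => (hS u).1 hu
  have hGS : Sᶜ ⊆ Gᶜ := fun x hx hxG => hx hxG.right_mem
  have hesc : ∀ b : HexVertex, b ∉ S → ∃ w : HexVertex, ((δ : ℂ) * hexCenter w).im ≤ h - 5 * δ ∧
      PathIn hexGraph Gᶜ b w := by
    intro b hb
    obtain ⟨w, hw, hbw⟩ := exists_pathIn_escape_floor hΩh hE hEfr hfl₀ hfl₁ hϱρ hδ hr hS'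
      (v := b) fun h' => hb ((hS b).2 h')
    exact ⟨w, hw, hbw.mono hGS⟩
  by_cases hzS : z ∈ S
  · -- descend to the first non-deep vertex
    have hzim : h < ((δ : ℂ) * hexCenter z).im := hΩh (hS' z hzS).1
    obtain ⟨w₀, q, hw₀, -⟩ :=
      exists_walk_down hδ z (L := ((δ : ℂ) * hexCenter z).im - (h - 6 * δ)) (by linarith)
    have hw₀S : w₀ ∉ S := by
      intro h'
      have := hΩh (hS' w₀ h').1
      simp only [mem_setOf_eq] at this
      linarith
    have hzw₀ : PathIn hexGraph univ z w₀ := pathIn_of_walk q fun _ _ => mem_univ _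
    obtain ⟨a, b, -, hbS, -, hab, hza⟩ := hzw₀.exit (R := S) hzS hw₀S
    have hza' : PathIn hexGraph S z a := hza.mono inter_subset_left
    have hcomp : {x | PathIn hexGraph S z x} ⊆ Gᶜ := fun x hx hxG => hz (hxG.trans hx.symm)
    have hzaG : PathIn hexGraph Gᶜ z a := (pathIn_component hza').mono hcomp
    obtain ⟨w, hw, hbw⟩ := hesc b hbS
    exact ⟨w, hw, (hzaG.tail hab (hGS hbS)).trans hbw⟩
  · exact hesc z hzS

/-- **The inner domain at a fixed mesh.**  In the setting of `exists_pathIn_escape` (with `Ω`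
bounded: `‖z‖ < R` on `Ω`), the `S`-component of any vertex `v₀` in the set `S` of deep vertices
is (the vertex set of) a finite, SIMPLY CONNECTED and CONNECTED hexagonal-lattice domain: it is
its own fill with respect to the far set `{Im ≤ h - 5δ} ∪ {‖·‖ ≥ R + 5δ}` (`exists_fill`), every
other vertex escaping to that far set around it (`exists_pathIn_compl_component`). [folklore] -/
theorem exists_inner_finset {Ω : Set ℂ} {h ρ ϱ δ r η R : ℝ} {p₀ p₁ : ℂ} {S : Set HexVertex}
    (hΩh : Ω ⊆ {z : ℂ | h < z.im}) (hE : IsConnected (closure Ω)ᶜ)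
    (hEfr : frontier (closure Ω)ᶜ = frontier Ω)
    (hfl₀ : {z : ℂ | h < z.im} ∩ ball p₀ ρ ⊆ Ω) (hfl₁ : {z : ℂ | h < z.im} ∩ ball p₁ ρ ⊆ Ω)
    (hϱρ : ϱ + δ ≤ ρ) (hδ : 0 < δ) (hr : 25 * δ ≤ r) (hR0 : 0 ≤ R) (hR : ∀ z ∈ Ω, ‖z‖ < R)
    (hS : ∀ u, u ∈ S ↔ ((δ : ℂ) * hexCenter u ∈ Ω ∧ η ≤ ((δ : ℂ) * hexCenter u).im ∧
      closedBall ((δ : ℂ) * hexCenter u) r ∩ {z : ℂ | h < z.im} ⊆ Ω ∪ ball p₀ ϱ ∪ ball p₁ ϱ))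
    (v₀ : HexVertex) :
    ∃ Λ : Finset HexVertex, hexDomainSimplyConnected Λ ∧
      (hexGraph.induce (↑Λ : Set HexVertex)).Preconnected ∧
      ∀ z : HexVertex, z ∈ Λ ↔ PathIn hexGraph S v₀ z := by
  set G : Set HexVertex := {x | PathIn hexGraph S v₀ x} with hG
  set F : Set HexVertex := {w | ((δ : ℂ) * hexCenter w).im ≤ h - 5 * δ ∨
    R + 5 * δ ≤ ‖(δ : ℂ) * hexCenter w‖} with hF
  have hS' : ∀ u ∈ S, (δ : ℂ) * hexCenter u ∈ Ω := fun u hu => ((hS u).1 hu).1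
  have hGim : ∀ x ∈ G, h < ((δ : ℂ) * hexCenter x).im := fun x hx => hΩh (hS' x hx.right_mem)
  have hGnorm : ∀ x ∈ G, ‖(δ : ℂ) * hexCenter x‖ < R := fun x hx => hR _ (hS' x hx.right_mem)
  -- `G` is connected through itself
  have hGG : ∀ x ∈ G, ∀ y ∈ G, PathIn hexGraph G x y := fun x hx y hy =>
    (pathIn_component (hx.symm.trans hy)).mono fun u hu => hx.trans hu
  -- the far set has finite complement
  have hfin : Fᶜ.Finite := by
    refine (finite_embMeshVertices_hex (isBounded_ball (x := (0 : ℂ)) (r := R + 5 * δ))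
      hδ.ne').subset fun w hw => ?_
    simp only [hF, mem_compl_iff, mem_setOf_eq, not_or, not_le] at hw
    rw [mem_embMeshVertices_iff, mem_ball_zero_iff]
    exact hw.2
  -- low vertices descend to far vertices, avoiding `G`
  have hdown : ∀ w : HexVertex, ((δ : ℂ) * hexCenter w).im ≤ h - 5 * δ →
      ∃ w' : HexVertex, R + 5 * δ ≤ ‖(δ : ℂ) * hexCenter w'‖ ∧ PathIn hexGraph Gᶜ w w' := by
    intro w hw
    obtain ⟨w', q, hw', hq⟩ := exists_walk_down hδ w
      (L := R + 6 * δ + |((δ : ℂ) * hexCenter w).im|) (by positivity)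
    refine ⟨w', ?_, pathIn_of_walk q fun u hu huG => ?_⟩
    · have h1 : -((δ : ℂ) * hexCenter w').im ≤ ‖(δ : ℂ) * hexCenter w'‖ :=
        (neg_le_abs _).trans (Complex.abs_im_le_norm _)
      have h2 := le_abs_self ((δ : ℂ) * hexCenter w).im
      linarith
    · have := hGim u huG
      have := (hq u hu).1
      linarith
  have hfar : ∀ w ∈ F, ∃ w' : HexVertex, R + 5 * δ ≤ ‖(δ : ℂ) * hexCenter w'‖ ∧
      PathIn hexGraph Gᶜ w w' := by
    rintro w (hw | hw)
    · exact hdown w hw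
    · exact ⟨w, hw, PathIn.refl fun hwG => by have := hGnorm w hwG; linarith⟩
  have hFF : ∀ w₁ ∈ F, ∀ w₂ ∈ F, PathIn hexGraph Gᶜ w₁ w₂ := by
    intro w₁ hw₁ w₂ hw₂
    obtain ⟨w₁', h₁, hp₁⟩ := hfar w₁ hw₁
    obtain ⟨w₂', h₂, hp₂⟩ := hfar w₂ hw₂
    exact (hp₁.trans (pathIn_far hδ hR0 hGnorm h₁ h₂)).trans hp₂.symm
  -- every vertex reaches the far set
  have hreach : ∀ z : HexVertex, ∃ w ∈ F, PathIn hexGraph univ z w := by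
    intro z
    obtain ⟨w, q, hw, -⟩ := exists_walk_down hδ z
      (L := |((δ : ℂ) * hexCenter z).im - (h - 6 * δ)|) (abs_nonneg _)
    refine ⟨w, Or.inl ?_, pathIn_of_walk q fun _ _ => mem_univ _⟩
    have := le_abs_self (((δ : ℂ) * hexCenter z).im - (h - 6 * δ))
    linarith
  obtain ⟨Λ, hGΛ, hsc, hconn, hmem⟩ := exists_fill hGG hfin hFF hreach
  refine ⟨Λ, hsc, hconn, fun z => ⟨fun hz => ?_, fun hz => hGΛ hz⟩⟩
  by_contra hzG
  obtain ⟨w, hw, hzw⟩ := exists_pathIn_compl_component hΩh hE hEfr hfl₀ hfl₁ hϱρ hδ hr hS v₀ hzG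
  exact (hmem z).1 hz ⟨w, Or.inl hw, hzw⟩

/-! ### Deep walks, exact floor rows, no bad edges -/

/-- A walk through `r`-deep vertices is a path inside `S` (`η ≤ h + r`). [folklore] -/
theorem pathIn_of_deep_walk {Ω : Set ℂ} {h ϱ δ r η : ℝ} {p₀ p₁ : ℂ} {S : Set HexVertex}
    (hΩh : Ω ⊆ {z : ℂ | h < z.im}) (hr : 0 ≤ r) (hη : η ≤ h + r)
    (hS : ∀ u, u ∈ S ↔ ((δ : ℂ) * hexCenter u ∈ Ω ∧ η ≤ ((δ : ℂ) * hexCenter u).im ∧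
      closedBall ((δ : ℂ) * hexCenter u) r ∩ {z : ℂ | h < z.im} ⊆ Ω ∪ ball p₀ ϱ ∪ ball p₁ ϱ))
    {v w : HexVertex} (q : hexGraph.Walk v w)
    (hq : ∀ u ∈ q.support, closedBall ((δ : ℂ) * hexCenter u) r ⊆ Ω) : PathIn hexGraph S v w := by
  refine pathIn_of_walk q fun u hu => (hS u).2 ⟨hq u hu (mem_closedBall_self hr), ?_,
    inter_subset_left.trans ((hq u hu).trans fun x hx => Or.inl (Or.inl hx))⟩
  have hlow : (δ : ℂ) * hexCenter u - (r : ℂ) * Complex.I ∈ closedBall ((δ : ℂ) * hexCenter u) r := by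
    rw [mem_closedBall, dist_eq_norm, sub_sub_cancel_left, norm_neg, norm_mul, Complex.norm_real,
      Complex.norm_I, mul_one, Real.norm_of_nonneg hr]
  have him : ((δ : ℂ) * hexCenter u - (r : ℂ) * Complex.I).im = ((δ : ℂ) * hexCenter u).im - r := by
    simp
  have := hΩh (hq u hu hlow)
  rw [mem_setOf_eq, him] at this
  linarith

/-- **Exact floor rows near a floor point.**  If the vertices of the target disc
`B̄(p + iρ/4, ρ/8)` above the floor point `p ∈ {p₀, p₁}` are in the `S`-component of `v₀`, then
so is every vertex of height `≥ η > h` within `ρ/16` of `p`: greedy ascent by `ρ/4` stays among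
deep vertices (`9ρ/16 + r ≤ ϱ`) and ends in the target disc. [folklore] -/
theorem pathIn_of_near_floor_point {Ω : Set ℂ} {h ρ ϱ δ r η : ℝ} {p₀ p₁ p : ℂ}
    {S : Set HexVertex} (hp : p = p₀ ∨ p = p₁) (hfl : {z : ℂ | h < z.im} ∩ ball p ρ ⊆ Ω)
    (hηh : h < η) (hδ : 0 < δ) (hδρ : δ ≤ ρ / 16) (hρ : 0 < ρ) (hrϱ : 9 * ρ / 16 + r ≤ ϱ)
    (hS : ∀ u, u ∈ S ↔ ((δ : ℂ) * hexCenter u ∈ Ω ∧ η ≤ ((δ : ℂ) * hexCenter u).im ∧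
      closedBall ((δ : ℂ) * hexCenter u) r ∩ {z : ℂ | h < z.im} ⊆ Ω ∪ ball p₀ ϱ ∪ ball p₁ ϱ))
    {v₀ : HexVertex}
    (hK : ∀ z : HexVertex, (δ : ℂ) * hexCenter z ∈ closedBall (p + (ρ / 4 : ℝ) * Complex.I) (ρ / 8) →
      PathIn hexGraph S v₀ z)
    {v : HexVertex} (hvη : η ≤ ((δ : ℂ) * hexCenter v).im)
    (hvp : dist ((δ : ℂ) * hexCenter v) p < ρ / 16) : PathIn hexGraph S v₀ v := by
  obtain ⟨z, q, hz, hq⟩ := exists_walk_up hδ v (L := ρ / 4) (by positivity)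
  have hballU : ball p ϱ ⊆ Ω ∪ ball p₀ ϱ ∪ ball p₁ ϱ := by
    rcases hp with rfl | rfl
    · exact fun x hx => Or.inl (Or.inr hx)
    · exact fun x hx => Or.inr hx
  have hvz : PathIn hexGraph S v z := by
    refine pathIn_of_walk q fun u hu => (hS u).2 ?_
    obtain ⟨hup, hdu⟩ := hq u hu
    have hup' : dist ((δ : ℂ) * hexCenter u) p < 9 * ρ / 16 := by
      calc dist ((δ : ℂ) * hexCenter u) p
          ≤ dist ((δ : ℂ) * hexCenter u) ((δ : ℂ) * hexCenter v) + dist ((δ : ℂ) * hexCenter v) p :=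
            dist_triangle _ _ _
        _ < 2 * (ρ / 4) + ρ / 16 := add_lt_add_of_le_of_lt hdu hvp
        _ = 9 * ρ / 16 := by ring
    refine ⟨hfl ⟨?_, mem_ball.2 (hup'.trans (by linarith))⟩, hvη.trans hup, ?_⟩
    · show h < ((δ : ℂ) * hexCenter u).im
      linarith
    · refine subset_trans (fun x hx => ?_) hballU
      rw [mem_ball]
      calc dist x p ≤ dist x ((δ : ℂ) * hexCenter u) + dist ((δ : ℂ) * hexCenter u) p :=
            dist_triangle _ _ _
        _ < r + 9 * ρ / 16 := add_lt_add_of_le_of_lt (mem_closedBall.1 hx.1) hup'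
        _ ≤ ϱ := by linarith
  have hzK : (δ : ℂ) * hexCenter z ∈ closedBall (p + (ρ / 4 : ℝ) * Complex.I) (ρ / 8) := by
    rw [mem_closedBall]
    calc dist ((δ : ℂ) * hexCenter z) (p + (ρ / 4 : ℝ) * Complex.I)
        ≤ dist ((δ : ℂ) * hexCenter z) ((δ : ℂ) * hexCenter v + (ρ / 4 : ℝ) * Complex.I) +
            dist ((δ : ℂ) * hexCenter v + (ρ / 4 : ℝ) * Complex.I) (p + (ρ / 4 : ℝ) * Complex.I) :=
          dist_triangle _ _ _
      _ ≤ δ + ρ / 16 := by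
          refine add_le_add hz ?_
          rw [dist_add_right]; exact hvp.le
      _ ≤ ρ / 8 := by linarith
  exact (hK z hzK).trans hvz.symm

/-- **No bad edges at deep vertices.**  The rescaled segment from a deep vertex `v` to an adjacent
vertex `w` with `δ c_w ∈ Ω` lies in `Ω` (`δ ≤ r`, `ϱ + δ ≤ ρ`): it lies in the `r`-disc about
`δ c_v`, hence in `Ω` or in a floor disc `B(pᵢ, ϱ)`, and in the latter case both endpoints are in
the convex set `{Im > h} ∩ B(pᵢ, ρ) ⊆ Ω`. [folklore] -/
theorem segment_subset_of_deep {Ω : Set ℂ} {h ρ ϱ δ r : ℝ} {p₀ p₁ : ℂ}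
    (hΩh : Ω ⊆ {z : ℂ | h < z.im})
    (hfl₀ : {z : ℂ | h < z.im} ∩ ball p₀ ρ ⊆ Ω) (hfl₁ : {z : ℂ | h < z.im} ∩ ball p₁ ρ ⊆ Ω)
    (hϱρ : ϱ + δ ≤ ρ) (hδ : 0 ≤ δ) (hδr : δ ≤ r) {v w : HexVertex}
    (hv : closedBall ((δ : ℂ) * hexCenter v) r ∩ {z : ℂ | h < z.im} ⊆ Ω ∪ ball p₀ ϱ ∪ ball p₁ ϱ)
    (hvΩ : (δ : ℂ) * hexCenter v ∈ Ω) (hwΩ : (δ : ℂ) * hexCenter w ∈ Ω) (hadj : hexGraph.Adj v w) :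
    segment ℝ ((δ : ℂ) * hexCenter v) ((δ : ℂ) * hexCenter w) ⊆ Ω := by
  intro x hx
  have hdvw : dist ((δ : ℂ) * hexCenter v) ((δ : ℂ) * hexCenter w) ≤ δ :=
    dist_smul_hexCenter_le_of_adj hδ hadj.symm
  have hxv : dist x ((δ : ℂ) * hexCenter v) ≤ δ := by
    have : x ∈ closedBall ((δ : ℂ) * hexCenter v) (dist ((δ : ℂ) * hexCenter w) ((δ : ℂ) * hexCenter v)) :=
      (convex_closedBall _ _).segment_subset (mem_closedBall_self dist_nonneg) (mem_closedBall.2 le_rfl) hx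
    rw [dist_comm] at hdvw
    exact (mem_closedBall.1 this).trans hdvw
  have hxw : dist x ((δ : ℂ) * hexCenter w) ≤ δ := by
    have : x ∈ closedBall ((δ : ℂ) * hexCenter w) (dist ((δ : ℂ) * hexCenter v) ((δ : ℂ) * hexCenter w)) :=
      (convex_closedBall _ _).segment_subset (mem_closedBall.2 le_rfl) (mem_closedBall_self dist_nonneg) hx
    exact (mem_closedBall.1 this).trans hdvw
  have hvim : h < ((δ : ℂ) * hexCenter v).im := hΩh hvΩ
  have hwim : h < ((δ : ℂ) * hexCenter w).im := hΩh hwΩ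
  have key : ∀ {p : ℂ}, {z : ℂ | h < z.im} ∩ ball p ρ ⊆ Ω → x ∈ ball p ϱ → x ∈ Ω := by
    intro p hfl hxp
    have hvp : (δ : ℂ) * hexCenter v ∈ {z : ℂ | h < z.im} ∩ ball p ρ := ⟨hvim, by
      rw [mem_ball]
      calc dist ((δ : ℂ) * hexCenter v) p ≤ dist x ((δ : ℂ) * hexCenter v) + dist x p :=
            dist_triangle_left _ _ _
        _ < δ + ϱ := add_lt_add_of_le_of_lt hxv (mem_ball.1 hxp)
        _ ≤ ρ := by linarith⟩
    have hwp : (δ : ℂ) * hexCenter w ∈ {z : ℂ | h < z.im} ∩ ball p ρ := ⟨hwim, by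
      rw [mem_ball]
      calc dist ((δ : ℂ) * hexCenter w) p ≤ dist x ((δ : ℂ) * hexCenter w) + dist x p :=
            dist_triangle_left _ _ _
        _ < δ + ϱ := add_lt_add_of_le_of_lt hxw (mem_ball.1 hxp)
        _ ≤ ρ := by linarith⟩
    exact hfl (((convex_halfSpace_im_gt h).inter (convex_ball p ρ)).segment_subset hvp hwp hx)
  have hxim : h < x.im := (convex_halfSpace_im_gt h).segment_subset hvim hwim hx
  rcases hv ⟨mem_closedBall.2 (hxv.trans hδr), hxim⟩ with (hxΩ | hx₀) | hx₁
  · exact hxΩ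
  · exact key hfl₀ hx₀
  · exact key hfl₁ hx₁

end Inner



/-- **Registered sub-goal `stub_canonicalTransfer_innerFloor`** (crux item stmt-CriticalPhenomena-10472,
line `floor-ratio-restriction-bootstrap`, stub `stub_canonicalTransfer`): the inner domain at a
fixed mesh is finite, simply connected and connected, registry form of `exists_inner_finset`.
[folklore] -/
theorem stub_canonicalTransfer_innerFloor :
    ∀ (Ω : Set ℂ) (h ρ ϱ δ r η R : ℝ) (p₀ p₁ : ℂ) (S : Set HexVertex) (v₀ : HexVertex),
    Ω ⊆ {z : ℂ | h < z.im} → IsConnected (closure Ω)ᶜ → frontier (closure Ω)ᶜ = frontier Ω →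
    {z : ℂ | h < z.im} ∩ ball p₀ ρ ⊆ Ω → {z : ℂ | h < z.im} ∩ ball p₁ ρ ⊆ Ω →
    ϱ + δ ≤ ρ → 0 < δ → 25 * δ ≤ r → 0 ≤ R → (∀ z ∈ Ω, ‖z‖ < R) →
    (∀ u, u ∈ S ↔ ((δ : ℂ) * hexCenter u ∈ Ω ∧ η ≤ ((δ : ℂ) * hexCenter u).im ∧
      closedBall ((δ : ℂ) * hexCenter u) r ∩ {z : ℂ | h < z.im} ⊆ Ω ∪ ball p₀ ϱ ∪ ball p₁ ϱ)) →
    ∃ Λ : Finset HexVertex, hexDomainSimplyConnected Λ ∧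
      (hexGraph.induce (↑Λ : Set HexVertex)).Preconnected ∧
      ∀ z : HexVertex, z ∈ Λ ↔ PathIn hexGraph S v₀ z :=
  fun _ _ _ _ _ _ _ _ _ _ _ v₀ hΩh hE hEfr hfl₀ hfl₁ hϱρ hδ hr hR0 hR hS =>
    exists_inner_finset hΩh hE hEfr hfl₀ hfl₁ hϱρ hδ hr hR0 hR hS v₀

end Summit.CriticalPhenomena.SAWScalingLimit.Theorems.ObservableToSLE.FloorRatio

end
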